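import Literature.NumberTheory.DiophantineGeometry.GenEllDeFamilyHconvOfCritSet
import Literature.NumberTheory.DiophantineGeometry.FibreConductorCritJunction
import HarnessLib

/-!
# [GenEll] Thm. 2.1 on the `D_e` route, family `t_c`: the placewise dichotomy OFF the bad primes of the
# critical values (the `hplace` input of the mixed separation/defect conductor summation)

S. Mochizuki, *Arithmetic elliptic curves in general position*, Math. J. Okayama Univ. **52** (2010),
proof of Thm. 2.1 p. 13 (Prop. 1.6 for the reduced divisor `t⁻¹(B)`) [cite: MochizukiGenEll2010, Thm 2.1 proof p.13].
Support file for the abc-iut cell's route item `GenEllTwo` (stmt-ABC-19679), W5 junction under the owner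
ruling #7 «R-b with defects» (2026-08-26): at the GOOD primes (off the finite set `S(e,c,A)` attached to the
CRITICAL VALUES only — independent of the mechanism's `B`) the sharp placewise inequalities hold with zero
defect; this file packages them in exactly the shape `hplace` consumed by
`FibreConductor.inv_finrank_mul_sum_logNorm_le_slope_of_prime_defect` / `…_of_prime_sep_of_prime_defect`
(`FibreConductorKappaDefect` / `FibreConductorKappaMixed`, abc-iut-w5-d009), composing three landed
theorems: `DeC.exists_badPrimes` (abc-iut-w5-d045), `DeC.hconv_off_badPrimes_of_critSetC`
(abc-iut-w5-d059) and the B-free junction `DeC.ord_placewise_of_crit` (`FibreConductorCritJunction`).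
Proof-only; classical; nothing here bears on [IUTchIII] Cor. 3.12.
-/

noncomputable section

namespace Literature.NumberTheory.DiophantineGeometry.GenEll

open _root_.Polynomial NumberField IsDedekindDomain
open Literature.IUT.LogVolume

open scoped Classical in
/-- **The placewise dichotomy pair OFF the bad primes of the critical values, `B` free** — the `hplace`
hypothesis of `FibreConductor.inv_finrank_mul_sum_logNorm_le_slope_of_prime_defect` /
`…_of_prime_sep_of_prime_defect` (abc-iut-w5-d009) with every good-place hypothesis DISCHARGED: for
`c ∈ ℚ^×`, `K ⊆ ℂ` finite over `ℚ` containing the roots of `R_c`, `A ⊆ K` finite with image `⊇ critSetC k c`,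
there is a finite set `S ∋ 2` of primes (`DeC.exists_badPrimes k hc A` ∪ the `hconv` primes of
`DeC.hconv_off_badPrimes_of_critSetC`) such that for every number field `L ⊇ K`, every `T ⊇ S`, every
point datum `(r, s, t, N)` in the family normal forms with `N ≠ 0`, every finite `B ⊇ A` (read in `L`) with
`t ∉ B`, and every finite place `w` NOT over `T`:
`(∃ b ∈ B, 0 < ord_w (t − b)) → 1 + ord⁺_w N ≤ Σ_{b∈B} ord⁺_w (t − b)` and
`(¬ …) → ord⁺_w N ≤ Σ_{b∈B} ord⁺_w (t − b)` — via the B-free junction `DeC.ord_placewise_of_crit`.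
[cite: MochizukiGenEll2010, Thm 2.1 proof p.13] -/
theorem DeC.hplace_off_badPrimes_of_critSetC (k : ℕ) {c : ℚ} (hc : c ≠ 0)
    (K : IntermediateField ℚ ℂ) [FiniteDimensional ℚ K]
    (hK : ∀ θ : ℂ, (DeCrit.RpolyC k (c : ℂ)).eval θ = 0 → θ ∈ K)
    (A : Finset K) (hA : ↑(DeCrit.critSetC k c) ⊆ ((↑) : K → ℂ) '' ↑A) :
    ∃ S : Finset ℕ, 2 ∈ S ∧ (∀ p ∈ S, p.Prime) ∧
      ∀ (L : Type) [Field L] [NumberField L] [Algebra K L] (T : Finset ℕ), S ⊆ T →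
        ∀ {r s t N : L},
        s ^ 2 = 1 - 4 * r ^ (2 * k + 1) → t * (r * s) = s + (c : L) * r ^ (k + 2) →
        N = -s ^ 3 + (c : L) * ((k + 1) * r ^ (k + 2) - 2 * r ^ (3 * k + 3)) → N ≠ 0 →
        ∀ (B : Finset L), A.map ⟨algebraMap K L, (algebraMap K L).injective⟩ ⊆ B →
        (∀ b ∈ B, t ≠ b) →
        ∀ w : HeightOneSpectrum (𝓞 L), w ∉ T.attach.biUnion (fun p => placesOver L p.1) →
          ((∃ b ∈ B, 0 < ord L w (t - b)) →
              1 + (ord L w N).toNat ≤ ∑ b ∈ B, (ord L w (t - b)).toNat) ∧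
          ((¬ ∃ b ∈ B, 0 < ord L w (t - b)) → (ord L w N).toNat ≤ ∑ b ∈ B, (ord L w (t - b)).toNat) := by
  classical
  haveI : NumberField K := NumberField.mk
  have hcK : ((c : ℚ) : K) ≠ 0 := Rat.cast_ne_zero.mpr hc
  obtain ⟨S₁, h2S₁, hS₁p, hS₁⟩ := DeC.exists_badPrimes (K := K) k hcK A
  obtain ⟨S₂, -, hS₂p, hS₂⟩ := DeC.hconv_off_badPrimes_of_critSetC k hc K hK A hA
  refine ⟨S₁ ∪ S₂, Finset.mem_union_left _ h2S₁, fun p hp => ?_, ?_⟩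
  · rcases Finset.mem_union.mp hp with h | h
    · exact hS₁p p h
    · exact hS₂p p h
  intro L _ _ _ T hST r s t N hcurve ht hN hN0 B hAB htB w hw
  set ι : K ↪ L := ⟨algebraMap K L, (algebraMap K L).injective⟩
  have hcL : algebraMap K L (c : K) = (c : L) := map_ratCast _ _
  -- off `T ⊇ S₁ ∪ S₂` one is off `S₁` and off `S₂`
  have hw₁ : w ∉ S₁.attach.biUnion (fun p => placesOver L p.1) := by
    intro h
    obtain ⟨p, -, hp⟩ := Finset.mem_biUnion.mp h
    exact hw (Finset.mem_biUnion.mpr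
      ⟨⟨p.1, hST (Finset.mem_union_left _ p.2)⟩, Finset.mem_attach _ _, hp⟩)
  obtain ⟨h2, hcv, hAint, -, hgap⟩ := hS₁ L w hw₁
  have hS₂T : S₂ ⊆ T := fun p hp => hST (Finset.mem_union_right _ hp)
  have hconv := hS₂ L T hS₂T w hw hcurve ht hN
  -- the B-free junction at `w`, hypotheses at `A.map ι` only
  refine DeC.ord_placewise_of_crit w k (c := algebraMap K L (c : K)) h2 hcv hcurve
    (by rw [hcL]; exact ht) (by rw [hcL]; exact hN) hN0 (A.map ι) B hAB htB
    (fun a => C ((algebraMap K L (c : K)) ^ 2) * X ^ (2 * k + 4) + C (4 * a ^ 2) * X ^ (2 * k + 3)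
      - C (8 * a) * X ^ (2 * k + 2) + C 4 * X ^ (2 * k + 1) - C (a ^ 2) * X ^ 2 + C (2 * a) * X - 1)
    (fun _ _ => rfl) ?_ ?_ ?_
  · intro a ha
    obtain ⟨b, hb, rfl⟩ := Finset.mem_map.mp ha
    exact hAint b hb
  · intro a ha ρ hρ hg0 hlt
    obtain ⟨b, hb, rfl⟩ := Finset.mem_map.mp ha
    exact hgap b hb _ rfl ρ hρ hg0 hlt
  · intro hN1
    exact hconv hN1

end Literature.NumberTheory.DiophantineGeometry.GenEll

end
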